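import Summits.AtomisticToContinuum.HydrodynamicLimit.Theorems.RelayRaceLocalityNearConstantShortTimeHLVelObjects
import Summits.AtomisticToContinuum.HydrodynamicLimit.Theorems.RelayRaceLocalityNearConstantShortTimeHLPiLemmas
import HarnessLib

/-!
# Crux `NearConstantShortTimeHL` (stmt-AtomisticToContinuum-12502), line `small-tilt-domination` —
# stub `lintegral_exp_chessIntegrand_le`

Support file for the crux `…Theses.RelayRaceLocality.NearConstantShortTimeHL`, line `small-tilt-domination`:
the PER-BALL (per-centre) step of the conditional Gaussian chessboard estimate `stub_velocityLD`. Fix the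
positions `x` of `m` particles, a centre `y ∈ 𝕋³`, the ball radius `ℓ` and the nominal ball content
`ν = m · 4/3 π ℓ³ ≥ 1`; let `N` be the number of particles in the ball `{i | dist(y, xᵢ) < ℓ}`. Under the
velocity law given the positions (`velMeasure`, independent Gaussians `vᵢ ∼ N(u₁(xᵢ), θ₁(xᵢ) I₃)` in the box
`M⁻¹ ≤ θ₁ ≤ M`, `‖u₁‖ ≤ M`) the exponential moment of `γ₁ ν · chessIntegrand` is bounded:

* `ballKernel ℓ y (x i) = (4/3 π ℓ³)⁻¹ 𝟙[i ∈ ball]`, so `ν · ballDens = N`, `ν • velDev = S_ξ`, `ν · enDev = S_Y`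
  (centred sums over the ball) and `ν · chessIntegrand = (2 + 2(1 + (1+c)N/ν)) min ν ((‖S_ξ‖² + S_Y²)/ν)
  + 2 S_Y 𝟙{S_Y > ν}` (`pb_nu_mul_chessIntegrand`);
* NORMAL ball (`N ≤ R'ν`): the weight is `≤ 2 + 2(1 + (1+c)R')`, `min ν` is subadditive, and after
  restriction to the block of the ball's particles (`lintegral_pi_comp_equiv_finset`) hypothesis (i) of the
  ball Gaussian estimate bounds the moment by `B` (`pb_lintegral_normal_le`);
* CROWDED ball (`R'ν < N`): `min ≤ ν < N/R'`, `S_Y 𝟙{S_Y > ν} ≤ Σ_{ball} (Yᵢ)₊`, the product structure of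
  `velMeasure` (`lintegral_fintype_prod_eq_prod'`) and the one-particle bound (ii) give
  `≤ exp(γ₁ (4/R' + 2(1+c) + 2B) N)` (`pb_lintegral_crowded_le`).

References: H.-T. Yau, Lett. Math. Phys. 22 (1991) §2.
-/

noncomputable section

namespace Summit.AtomisticToContinuum.HydrodynamicLimit.Theorems.NearConstantShortTimeHL

open MeasureTheory ProbabilityTheory Set
open Literature.MathematicalPhysics.KineticTheory Literature.Analysis.FluidPDE Literature.Analysis.FunctionSpaces
open scoped ENNReal BigOperators

/-- `min ν (a + b) ≤ min ν a + min ν b` for `0 ≤ ν, a, b`. [folklore] -/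
theorem pb_min_add_le {ν a b : ℝ} (hν : 0 ≤ ν) (ha : 0 ≤ a) (hb : 0 ≤ b) :
    min ν (a + b) ≤ min ν a + min ν b := by
  rcases le_total ν a with h1 | h1
  · rw [min_eq_left h1]
    exact (min_le_left _ _).trans (le_add_of_nonneg_right (le_min hν hb))
  · rw [min_eq_right h1]
    rcases le_total ν b with h2 | h2
    · rw [min_eq_left h2]
      exact (min_le_left _ _).trans (by linarith)
    · rw [min_eq_right h2]
      exact min_le_right _ _

/-- Kernel-weighted sums are `(4/3 π ℓ³)⁻¹ •` indicator-weighted sums (`ballKernel ℓ y z =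
(4/3 π ℓ³)⁻¹ 𝟙{dist(y,z) < ℓ}`). [folklore] -/
theorem pb_sum_ballKernel_smul {m : ℕ} {E : Type*} [AddCommGroup E] [Module ℝ E] (ℓ : ℝ)
    (x : Fin m → T3) (y : T3) (F : Fin m → E) :
    ∑ i, ballKernel ℓ y (x i) • F i =
      (4 / 3 * Real.pi * ℓ ^ 3)⁻¹ • ∑ i, (if Torus.euclidDist y (x i) < ℓ then (1 : ℝ) else 0) • F i := by
  rw [Finset.smul_sum]
  refine Finset.sum_congr rfl fun i _ => ?_
  unfold ballKernel
  split_ifs <;> simp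

/-- Indicator-weighted sums over all particles are sums over an enumeration of the ball. [folklore] -/
theorem pb_sum_ite_smul_eq_sum_equiv {m : ℕ} {E : Type*} [AddCommGroup E] [Module ℝ E] (ℓ : ℝ)
    (x : Fin m → T3) (y : T3) (F : Fin m → E) {k : ℕ}
    (e : Fin k ≃ ↥(Finset.univ.filter fun i => Torus.euclidDist y (x i) < ℓ)) :
    ∑ i, (if Torus.euclidDist y (x i) < ℓ then (1 : ℝ) else 0) • F i = ∑ a, F (e a) := by
  have h1 : ∑ i, (if Torus.euclidDist y (x i) < ℓ then (1 : ℝ) else 0) • F i =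
      ∑ i ∈ Finset.univ.filter (fun i => Torus.euclidDist y (x i) < ℓ), F i := by
    rw [Finset.sum_filter]
    refine Finset.sum_congr rfl fun i _ => ?_
    split_ifs <;> simp
  rw [h1]
  exact ((Finset.sum_coe_sort _ F).symm.trans (Equiv.sum_comp e fun s => F s).symm)

/-- `ballDens = N / ν` with `N` the number of particles in the ball and `ν = m · 4/3 π ℓ³`. [folklore] -/
theorem pb_ballDens_eq {m : ℕ} (ℓ : ℝ) (x : Fin m → T3) (y : T3) :
    ballDens ℓ x y = ((m : ℝ) * (4 / 3 * Real.pi * ℓ ^ 3))⁻¹ *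
      ((Finset.univ.filter fun i => Torus.euclidDist y (x i) < ℓ).card : ℝ) := by
  have h := pb_sum_ballKernel_smul ℓ x y (fun _ => (1 : ℝ))
  simp only [smul_eq_mul, mul_one] at h
  rw [ballDens, h, Finset.sum_boole, ← mul_assoc, ← mul_inv]

/-- `velDev = ν⁻¹ • S_ξ`. [folklore] -/
theorem pb_velDev_eq {m : ℕ} (ℓ : ℝ) (u₁ : T3 → V3) (x : Fin m → T3) (v : Fin m → V3) (y : T3) :
    velDev ℓ u₁ x v y = ((m : ℝ) * (4 / 3 * Real.pi * ℓ ^ 3))⁻¹ •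
      ∑ i, (if Torus.euclidDist y (x i) < ℓ then (1 : ℝ) else 0) • (v i - u₁ (x i)) := by
  rw [velDev, pb_sum_ballKernel_smul, smul_smul, ← mul_inv]

/-- `enDev = ν⁻¹ S_Y`. [folklore] -/
theorem pb_enDev_eq {m : ℕ} (ℓ : ℝ) (θ₁ : T3 → ℝ) (u₁ : T3 → V3) (x : Fin m → T3) (v : Fin m → V3)
    (y : T3) :
    enDev ℓ θ₁ u₁ x v y = ((m : ℝ) * (4 / 3 * Real.pi * ℓ ^ 3))⁻¹ *
      ∑ i, (if Torus.euclidDist y (x i) < ℓ then (1 : ℝ) else 0) *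
        (‖v i‖ ^ 2 / 2 - ‖u₁ (x i)‖ ^ 2 / 2 - 3 / 2 * θ₁ (x i)) := by
  have h := pb_sum_ballKernel_smul ℓ x y (fun i => ‖v i‖ ^ 2 / 2 - ‖u₁ (x i)‖ ^ 2 / 2 - 3 / 2 * θ₁ (x i))
  simp only [smul_eq_mul] at h
  rw [enDev, h, ← mul_assoc, ← mul_inv]

/-- The scaled chessboard integrand in terms of the ball sums: `ν · chessIntegrand =
(2 + 2(1 + (1+c) N/ν)) · min ν ((‖S_ξ‖² + S_Y²)/ν) + 2 · S_Y 𝟙{S_Y > ν}`. [folklore] -/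
theorem pb_nu_mul_chessIntegrand {m : ℕ} (M ℓ : ℝ) (θ₁ : T3 → ℝ) (u₁ : T3 → V3) (x : Fin m → T3)
    (v : Fin m → V3) (y : T3) (hν : 0 < (m : ℝ) * (4 / 3 * Real.pi * ℓ ^ 3)) :
    (m : ℝ) * (4 / 3 * Real.pi * ℓ ^ 3) * chessIntegrand M ℓ θ₁ u₁ x v y =
      (2 + 2 * (1 + (1 + (M ^ 2 / 2 + 3 / 2 * M)) *
          (((m : ℝ) * (4 / 3 * Real.pi * ℓ ^ 3))⁻¹ *
            ((Finset.univ.filter fun i => Torus.euclidDist y (x i) < ℓ).card : ℝ)))) *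
        min ((m : ℝ) * (4 / 3 * Real.pi * ℓ ^ 3))
          ((‖∑ i, (if Torus.euclidDist y (x i) < ℓ then (1 : ℝ) else 0) • (v i - u₁ (x i))‖ ^ 2 +
              (∑ i, (if Torus.euclidDist y (x i) < ℓ then (1 : ℝ) else 0) *
                (‖v i‖ ^ 2 / 2 - ‖u₁ (x i)‖ ^ 2 / 2 - 3 / 2 * θ₁ (x i))) ^ 2) /
            ((m : ℝ) * (4 / 3 * Real.pi * ℓ ^ 3))) +
      2 * (if (m : ℝ) * (4 / 3 * Real.pi * ℓ ^ 3) <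
              ∑ i, (if Torus.euclidDist y (x i) < ℓ then (1 : ℝ) else 0) *
                (‖v i‖ ^ 2 / 2 - ‖u₁ (x i)‖ ^ 2 / 2 - 3 / 2 * θ₁ (x i))
            then ∑ i, (if Torus.euclidDist y (x i) < ℓ then (1 : ℝ) else 0) *
                (‖v i‖ ^ 2 / 2 - ‖u₁ (x i)‖ ^ 2 / 2 - 3 / 2 * θ₁ (x i)) else 0) := by
  rw [chessIntegrand, pb_ballDens_eq, pb_velDev_eq, pb_enDev_eq]
  set ν : ℝ := (m : ℝ) * (4 / 3 * Real.pi * ℓ ^ 3)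
  set Sξ : V3 := ∑ i, (if Torus.euclidDist y (x i) < ℓ then (1 : ℝ) else 0) • (v i - u₁ (x i))
  set SY : ℝ := ∑ i, (if Torus.euclidDist y (x i) < ℓ then (1 : ℝ) else 0) *
    (‖v i‖ ^ 2 / 2 - ‖u₁ (x i)‖ ^ 2 / 2 - 3 / 2 * θ₁ (x i))
  set N : ℝ := ((Finset.univ.filter fun i => Torus.euclidDist y (x i) < ℓ).card : ℝ)
  have hν0 : ν ≠ 0 := hν.ne'
  have h1 : ‖ν⁻¹ • Sξ‖ ^ 2 + (ν⁻¹ * SY) ^ 2 = ν⁻¹ * ((‖Sξ‖ ^ 2 + SY ^ 2) / ν) := by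
    rw [norm_smul, Real.norm_eq_abs, abs_of_pos (inv_pos.2 hν), div_eq_mul_inv]
    ring
  have h2 : ν * min 1 (ν⁻¹ * ((‖Sξ‖ ^ 2 + SY ^ 2) / ν)) = min ν ((‖Sξ‖ ^ 2 + SY ^ 2) / ν) := by
    rw [mul_min_of_nonneg _ _ hν.le, mul_one, mul_inv_cancel_left₀ hν0]
  have h3 : (1 < ν⁻¹ * SY ↔ ν < SY) := by rw [inv_mul_eq_div, one_lt_div hν]
  have h4 : ν * (if 1 < ν⁻¹ * SY then ν⁻¹ * SY else 0) = if ν < SY then SY else 0 := by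
    by_cases h : ν < SY
    · rw [if_pos (h3.2 h), if_pos h, mul_inv_cancel_left₀ hν0]
    · rw [if_neg (mt h3.1 h), if_neg h, mul_zero]
  rw [h1]
  linear_combination (2 + 2 * (1 + (1 + (M ^ 2 / 2 + 3 / 2 * M)) * (ν⁻¹ * N))) * h2 + 2 * h4

/-- NORMAL ball (`N ≤ R'ν`): `γ₁ ν · chessIntegrand ≤ γ₀ (min ν (‖S_ξ‖²/ν) + min ν (S_Y²/ν) + S_Y 𝟙{S_Y > ν})`
(weight `≤ 2 + 2(1 + (1+c)R')`, subadditivity of `min ν`, `2 ≤` weight). [cite: Yau1991, §2] -/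
theorem pb_exponent_le_normal {M R' γ₀ γ₁ : ℝ} (hM : 1 ≤ M) (hγ₁ : 0 ≤ γ₁)
    (hγW : γ₁ * (2 + 2 * (1 + (1 + (M ^ 2 / 2 + 3 / 2 * M)) * R')) ≤ γ₀)
    {m : ℕ} {ℓ : ℝ} (hν : 0 < (m : ℝ) * (4 / 3 * Real.pi * ℓ ^ 3)) (θ₁ : T3 → ℝ) (u₁ : T3 → V3)
    (x : Fin m → T3) (y : T3)
    (hN : ((Finset.univ.filter fun i => Torus.euclidDist y (x i) < ℓ).card : ℝ) ≤
      R' * ((m : ℝ) * (4 / 3 * Real.pi * ℓ ^ 3))) (v : Fin m → V3) :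
    γ₁ * ((m : ℝ) * (4 / 3 * Real.pi * ℓ ^ 3)) * chessIntegrand M ℓ θ₁ u₁ x v y ≤
      γ₀ * (min ((m : ℝ) * (4 / 3 * Real.pi * ℓ ^ 3))
          (‖∑ i, (if Torus.euclidDist y (x i) < ℓ then (1 : ℝ) else 0) • (v i - u₁ (x i))‖ ^ 2 /
            ((m : ℝ) * (4 / 3 * Real.pi * ℓ ^ 3))) +
        min ((m : ℝ) * (4 / 3 * Real.pi * ℓ ^ 3))
          ((∑ i, (if Torus.euclidDist y (x i) < ℓ then (1 : ℝ) else 0) *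
              (‖v i‖ ^ 2 / 2 - ‖u₁ (x i)‖ ^ 2 / 2 - 3 / 2 * θ₁ (x i))) ^ 2 /
            ((m : ℝ) * (4 / 3 * Real.pi * ℓ ^ 3))) +
        (if (m : ℝ) * (4 / 3 * Real.pi * ℓ ^ 3) <
            ∑ i, (if Torus.euclidDist y (x i) < ℓ then (1 : ℝ) else 0) *
              (‖v i‖ ^ 2 / 2 - ‖u₁ (x i)‖ ^ 2 / 2 - 3 / 2 * θ₁ (x i))
          then ∑ i, (if Torus.euclidDist y (x i) < ℓ then (1 : ℝ) else 0) *
              (‖v i‖ ^ 2 / 2 - ‖u₁ (x i)‖ ^ 2 / 2 - 3 / 2 * θ₁ (x i)) else 0)) := by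
  rw [mul_assoc, pb_nu_mul_chessIntegrand M ℓ θ₁ u₁ x v y hν]
  set ν : ℝ := (m : ℝ) * (4 / 3 * Real.pi * ℓ ^ 3)
  set Sξ : V3 := ∑ i, (if Torus.euclidDist y (x i) < ℓ then (1 : ℝ) else 0) • (v i - u₁ (x i))
  set SY : ℝ := ∑ i, (if Torus.euclidDist y (x i) < ℓ then (1 : ℝ) else 0) *
    (‖v i‖ ^ 2 / 2 - ‖u₁ (x i)‖ ^ 2 / 2 - 3 / 2 * θ₁ (x i))
  set N : ℝ := ((Finset.univ.filter fun i => Torus.euclidDist y (x i) < ℓ).card : ℝ)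
  set c : ℝ := M ^ 2 / 2 + 3 / 2 * M
  set T : ℝ := (if ν < SY then SY else 0)
  set Q : ℝ := min ν (‖Sξ‖ ^ 2 / ν) + min ν (SY ^ 2 / ν)
  have hc0 : 0 ≤ 1 + c := by positivity
  have hR0 : 0 ≤ R' := by
    have h0 : (0 : ℝ) ≤ N := Nat.cast_nonneg _
    nlinarith [h0.trans hN]
  have hρ : ν⁻¹ * N ≤ R' := by
    rw [inv_mul_le_iff₀ hν, mul_comm ν R']
    exact hN
  have hW : 2 + 2 * (1 + (1 + c) * (ν⁻¹ * N)) ≤ 2 + 2 * (1 + (1 + c) * R') := by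
    have := mul_le_mul_of_nonneg_left hρ hc0
    linarith
  have hW0 : 0 ≤ 2 + 2 * (1 + (1 + c) * (ν⁻¹ * N)) := by positivity
  have h2W : (2 : ℝ) ≤ 2 + 2 * (1 + (1 + c) * R') := by
    have := mul_nonneg hc0 hR0
    linarith
  have hP : min ν ((‖Sξ‖ ^ 2 + SY ^ 2) / ν) ≤ Q := by
    rw [add_div]
    exact pb_min_add_le hν.le (by positivity) (by positivity)
  have hP0 : 0 ≤ min ν ((‖Sξ‖ ^ 2 + SY ^ 2) / ν) := le_min hν.le (by positivity)
  have hQ0 : 0 ≤ Q := add_nonneg (le_min hν.le (by positivity)) (le_min hν.le (by positivity))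
  have hT0 : 0 ≤ T := by
    simp only [T]
    split_ifs with h
    · exact hν.le.trans h.le
    · exact le_rfl
  have hmain : (2 + 2 * (1 + (1 + c) * (ν⁻¹ * N))) * min ν ((‖Sξ‖ ^ 2 + SY ^ 2) / ν) + 2 * T ≤
      (2 + 2 * (1 + (1 + c) * R')) * (Q + T) := by
    have h1 := mul_le_mul hW hP hP0 (hW0.trans hW)
    have h2 := mul_le_mul_of_nonneg_right h2W hT0
    linarith
  calc γ₁ * ((2 + 2 * (1 + (1 + c) * (ν⁻¹ * N))) * min ν ((‖Sξ‖ ^ 2 + SY ^ 2) / ν) + 2 * T)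
      ≤ γ₁ * ((2 + 2 * (1 + (1 + c) * R')) * (Q + T)) := mul_le_mul_of_nonneg_left hmain hγ₁
    _ = γ₁ * (2 + 2 * (1 + (1 + c) * R')) * (Q + T) := by ring
    _ ≤ γ₀ * (Q + T) := mul_le_mul_of_nonneg_right hγW (add_nonneg hQ0 hT0)

/-- CROWDED ball (`R'ν < N`): `γ₁ ν · chessIntegrand ≤ γ₁ (4/R' + 2(1+c)) N + Σᵢ 2γ₁ 𝟙[i ∈ ball] (Yᵢ)₊`
(cap `min ≤ ν`, `4ν ≤ 4N/R'`, `S_Y 𝟙{S_Y > ν} ≤ Σ_{ball} (Yᵢ)₊`). [cite: Yau1991, §2] -/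
theorem pb_exponent_le_crowded {M R' γ₁ : ℝ} (hM : 1 ≤ M) (hR' : 0 < R') (hγ₁ : 0 ≤ γ₁)
    {m : ℕ} {ℓ : ℝ} (hν : 0 < (m : ℝ) * (4 / 3 * Real.pi * ℓ ^ 3)) (θ₁ : T3 → ℝ) (u₁ : T3 → V3)
    (x : Fin m → T3) (y : T3)
    (hN : R' * ((m : ℝ) * (4 / 3 * Real.pi * ℓ ^ 3)) <
      ((Finset.univ.filter fun i => Torus.euclidDist y (x i) < ℓ).card : ℝ)) (v : Fin m → V3) :
    γ₁ * ((m : ℝ) * (4 / 3 * Real.pi * ℓ ^ 3)) * chessIntegrand M ℓ θ₁ u₁ x v y ≤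
      γ₁ * (4 / R' + 2 * (1 + (M ^ 2 / 2 + 3 / 2 * M))) *
          ((Finset.univ.filter fun i => Torus.euclidDist y (x i) < ℓ).card : ℝ) +
        ∑ i, 2 * γ₁ * (if Torus.euclidDist y (x i) < ℓ then (1 : ℝ) else 0) *
          max 0 (‖v i‖ ^ 2 / 2 - ‖u₁ (x i)‖ ^ 2 / 2 - 3 / 2 * θ₁ (x i)) := by
  rw [mul_assoc, pb_nu_mul_chessIntegrand M ℓ θ₁ u₁ x v y hν]
  set ν : ℝ := (m : ℝ) * (4 / 3 * Real.pi * ℓ ^ 3)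
  set Sξ : V3 := ∑ i, (if Torus.euclidDist y (x i) < ℓ then (1 : ℝ) else 0) • (v i - u₁ (x i))
  set SY : ℝ := ∑ i, (if Torus.euclidDist y (x i) < ℓ then (1 : ℝ) else 0) *
    (‖v i‖ ^ 2 / 2 - ‖u₁ (x i)‖ ^ 2 / 2 - 3 / 2 * θ₁ (x i)) with hSY
  set N : ℝ := ((Finset.univ.filter fun i => Torus.euclidDist y (x i) < ℓ).card : ℝ)
  set c : ℝ := M ^ 2 / 2 + 3 / 2 * M
  set P : ℝ := min ν ((‖Sξ‖ ^ 2 + SY ^ 2) / ν)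
  set Z : ℝ := ∑ i, (if Torus.euclidDist y (x i) < ℓ then (1 : ℝ) else 0) *
    max 0 (‖v i‖ ^ 2 / 2 - ‖u₁ (x i)‖ ^ 2 / 2 - 3 / 2 * θ₁ (x i)) with hZ
  have hc0 : 0 ≤ 1 + c := by positivity
  have hW0 : 0 ≤ 2 + 2 * (1 + (1 + c) * (ν⁻¹ * N)) := by positivity
  have hWP : (2 + 2 * (1 + (1 + c) * (ν⁻¹ * N))) * P ≤ 4 * ν + 2 * (1 + c) * N := by
    calc (2 + 2 * (1 + (1 + c) * (ν⁻¹ * N))) * P ≤ (2 + 2 * (1 + (1 + c) * (ν⁻¹ * N))) * ν :=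
          mul_le_mul_of_nonneg_left (min_le_left _ _) hW0
      _ = 4 * ν + 2 * (1 + c) * N := by
          field_simp
          ring
  have h4ν : 4 * ν ≤ 4 / R' * N := by
    rw [div_mul_eq_mul_div, le_div_iff₀ hR']
    nlinarith
  have hχ0 : ∀ i, (0 : ℝ) ≤ (if Torus.euclidDist y (x i) < ℓ then (1 : ℝ) else 0) := fun i => by
    split_ifs
    · exact zero_le_one
    · exact le_rfl
  have hZ0 : 0 ≤ Z := Finset.sum_nonneg fun i _ => mul_nonneg (hχ0 i) (le_max_left _ _)
  have hT : (if ν < SY then SY else 0) ≤ Z := by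
    split_ifs with h
    · exact Finset.sum_le_sum fun i _ => mul_le_mul_of_nonneg_left (le_max_right _ _) (hχ0 i)
    · exact hZ0
  have hsum : ∑ i, 2 * γ₁ * (if Torus.euclidDist y (x i) < ℓ then (1 : ℝ) else 0) *
      max 0 (‖v i‖ ^ 2 / 2 - ‖u₁ (x i)‖ ^ 2 / 2 - 3 / 2 * θ₁ (x i)) = 2 * γ₁ * Z := by
    rw [hZ, Finset.mul_sum]
    exact Finset.sum_congr rfl fun i _ => by ring
  rw [hsum]
  have hmain : (2 + 2 * (1 + (1 + c) * (ν⁻¹ * N))) * P + 2 * (if ν < SY then SY else 0) ≤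
      (4 / R' + 2 * (1 + c)) * N + 2 * Z := by
    linarith
  calc γ₁ * ((2 + 2 * (1 + (1 + c) * (ν⁻¹ * N))) * P + 2 * (if ν < SY then SY else 0))
      ≤ γ₁ * ((4 / R' + 2 * (1 + c)) * N + 2 * Z) := mul_le_mul_of_nonneg_left hmain hγ₁
    _ = γ₁ * (4 / R' + 2 * (1 + c)) * N + 2 * γ₁ * Z := by ring

/-- Measurability of the block functional of hypothesis (i) of the ball Gaussian estimate. [folklore] -/
theorem pb_measurable_blockFn {k : ℕ} (γ₀ ν : ℝ) (u : Fin k → V3) (θ : Fin k → ℝ) :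
    Measurable fun w : Fin k → V3 => ENNReal.ofReal (Real.exp (γ₀ *
      (min ν (‖∑ i, (w i - u i)‖ ^ 2 / ν) +
        min ν ((∑ i, (‖w i‖ ^ 2 / 2 - ‖u i‖ ^ 2 / 2 - 3 / 2 * θ i)) ^ 2 / ν) +
        (if ν < ∑ i, (‖w i‖ ^ 2 / 2 - ‖u i‖ ^ 2 / 2 - 3 / 2 * θ i)
          then ∑ i, (‖w i‖ ^ 2 / 2 - ‖u i‖ ^ 2 / 2 - 3 / 2 * θ i) else 0)))) := by
  have h1 : Measurable fun w : Fin k → V3 => ∑ i, (w i - u i) :=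
    Finset.measurable_sum _ fun i _ => (measurable_pi_apply i).sub_const _
  have h2 : Measurable fun w : Fin k → V3 => ∑ i, (‖w i‖ ^ 2 / 2 - ‖u i‖ ^ 2 / 2 - 3 / 2 * θ i) :=
    Finset.measurable_sum _ fun i _ =>
      ((((measurable_pi_apply i).norm.pow_const 2).div_const 2).sub_const _).sub_const _
  refine (Real.measurable_exp.comp (Measurable.const_mul ?_ γ₀)).ennreal_ofReal
  exact ((measurable_const.min ((h1.norm.pow_const 2).div_const ν)).add
    (measurable_const.min ((h2.pow_const 2).div_const ν))).add
    (Measurable.ite (measurableSet_lt measurable_const h2) h2 measurable_const)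

/-- NORMAL ball: the exponential moment is bounded by `B` (restriction to the block of the ball's particles,
`lintegral_pi_comp_equiv_finset`, and hypothesis (i) of the ball Gaussian estimate). [cite: Yau1991, §2] -/
theorem pb_lintegral_normal_le {M R' γ₀ B : ℝ} (hM : 1 ≤ M)
    (hI : ∀ ν : ℝ, 1 ≤ ν → ∀ k : ℕ, (k : ℝ) ≤ R' * ν → ∀ (u : Fin k → V3) (θ : Fin k → ℝ),
      (∀ i, M⁻¹ ≤ θ i ∧ θ i ≤ M ∧ ‖u i‖ ≤ M) →
      ∫⁻ v, ENNReal.ofReal (Real.exp (γ₀ * (min ν (‖∑ i, (v i - u i)‖ ^ 2 / ν) +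
        min ν ((∑ i, (‖v i‖ ^ 2 / 2 - ‖u i‖ ^ 2 / 2 - 3 / 2 * θ i)) ^ 2 / ν) +
        (if ν < ∑ i, (‖v i‖ ^ 2 / 2 - ‖u i‖ ^ 2 / 2 - 3 / 2 * θ i)
          then ∑ i, (‖v i‖ ^ 2 / 2 - ‖u i‖ ^ 2 / 2 - 3 / 2 * θ i) else 0))))
        ∂(Measure.pi fun i => gaussMeasure (u i) (θ i)) ≤ ENNReal.ofReal B)
    {m : ℕ} {ℓ : ℝ} (hν : 1 ≤ (m : ℝ) * (4 / 3 * Real.pi * ℓ ^ 3))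
    {θ₁ : T3 → ℝ} {u₁ : T3 → V3} (hbox : ∀ y, M⁻¹ ≤ θ₁ y ∧ θ₁ y ≤ M ∧ ‖u₁ y‖ ≤ M)
    {γ₁ : ℝ} (hγ₁ : 0 ≤ γ₁) (hγW : γ₁ * (2 + 2 * (1 + (1 + (M ^ 2 / 2 + 3 / 2 * M)) * R')) ≤ γ₀)
    (x : Fin m → T3) (y : T3)
    (hN : ((Finset.univ.filter fun i => Torus.euclidDist y (x i) < ℓ).card : ℝ) ≤
      R' * ((m : ℝ) * (4 / 3 * Real.pi * ℓ ^ 3))) :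
    ∫⁻ v, ENNReal.ofReal (Real.exp (γ₁ * ((m : ℝ) * (4 / 3 * Real.pi * ℓ ^ 3)) *
        chessIntegrand M ℓ θ₁ u₁ x v y)) ∂(velMeasure u₁ θ₁ x) ≤ ENNReal.ofReal B := by
  set S : Finset (Fin m) := Finset.univ.filter fun i => Torus.euclidDist y (x i) < ℓ
  set ν : ℝ := (m : ℝ) * (4 / 3 * Real.pi * ℓ ^ 3)
  have hν0 : 0 < ν := one_pos.trans_le hν
  set e : Fin S.card ≃ ↥S := S.equivFin.symm
  -- the block integral, by hypothesis (i) after restriction to the block of the ball's particles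
  have hblock : ∫⁻ v : Fin m → V3, ENNReal.ofReal (Real.exp (γ₀ *
      (min ν (‖∑ a, (v (e a) - u₁ (x (e a)))‖ ^ 2 / ν) +
        min ν ((∑ a, (‖v (e a)‖ ^ 2 / 2 - ‖u₁ (x (e a))‖ ^ 2 / 2 - 3 / 2 * θ₁ (x (e a)))) ^ 2 / ν) +
        (if ν < ∑ a, (‖v (e a)‖ ^ 2 / 2 - ‖u₁ (x (e a))‖ ^ 2 / 2 - 3 / 2 * θ₁ (x (e a)))
          then ∑ a, (‖v (e a)‖ ^ 2 / 2 - ‖u₁ (x (e a))‖ ^ 2 / 2 - 3 / 2 * θ₁ (x (e a))) else 0))))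
      ∂(velMeasure u₁ θ₁ x) ≤ ENNReal.ofReal B := by
    have h1 := lintegral_pi_comp_equiv_finset (fun i => gaussMeasure (u₁ (x i)) (θ₁ (x i))) S e _
      (pb_measurable_blockFn γ₀ ν (fun a => u₁ (x (e a))) (fun a => θ₁ (x (e a))))
    have h2 := hI ν hν S.card hN (fun a => u₁ (x (e a))) (fun a => θ₁ (x (e a))) fun a => hbox _
    unfold velMeasure
    exact h1.trans_le h2
  refine le_trans (lintegral_mono fun v => ?_) hblock
  have h := pb_exponent_le_normal hM hγ₁ hγW hν0 θ₁ u₁ x y hN v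
  rw [pb_sum_ite_smul_eq_sum_equiv ℓ x y (fun i => v i - u₁ (x i)) e] at h
  have hY := pb_sum_ite_smul_eq_sum_equiv ℓ x y
    (fun i => ‖v i‖ ^ 2 / 2 - ‖u₁ (x i)‖ ^ 2 / 2 - 3 / 2 * θ₁ (x i)) e
  simp only [smul_eq_mul] at hY
  rw [hY] at h
  exact ENNReal.ofReal_le_ofReal (Real.exp_le_exp.2 h)

/-- CROWDED ball: the exponential moment is bounded by `exp(γ₁ (4/R' + 2(1+c) + 2B) N)` (cap `min ≤ ν`,
`4ν ≤ 4N/R'`, product structure of `velMeasure` and hypothesis (ii) at the rates `sᵢ = 2γ₁ 𝟙[i ∈ ball]`).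
[cite: Yau1991, §2] -/
theorem pb_lintegral_crowded_le {M R' γ₀ B : ℝ} (hM : 1 ≤ M) (hR' : 0 < R') (hB : 1 ≤ B)
    (hII : ∀ s : ℝ, 0 ≤ s → s ≤ γ₀ → ∀ (u : V3) (θ : ℝ), M⁻¹ ≤ θ → θ ≤ M → ‖u‖ ≤ M →
      ∫⁻ v, ENNReal.ofReal (Real.exp (s * max 0 (‖v‖ ^ 2 / 2 - ‖u‖ ^ 2 / 2 - 3 / 2 * θ))) ∂(gaussMeasure u θ) ≤
        ENNReal.ofReal (Real.exp (B * s)))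
    {m : ℕ} {ℓ : ℝ} (hν : 0 < (m : ℝ) * (4 / 3 * Real.pi * ℓ ^ 3))
    {θ₁ : T3 → ℝ} {u₁ : T3 → V3} (hbox : ∀ y, M⁻¹ ≤ θ₁ y ∧ θ₁ y ≤ M ∧ ‖u₁ y‖ ≤ M)
    {γ₁ : ℝ} (hγ₁ : 0 ≤ γ₁) (h2γ : 2 * γ₁ ≤ γ₀) (x : Fin m → T3) (y : T3)
    (hN : R' * ((m : ℝ) * (4 / 3 * Real.pi * ℓ ^ 3)) <
      ((Finset.univ.filter fun i => Torus.euclidDist y (x i) < ℓ).card : ℝ)) :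
    ∫⁻ v, ENNReal.ofReal (Real.exp (γ₁ * ((m : ℝ) * (4 / 3 * Real.pi * ℓ ^ 3)) *
        chessIntegrand M ℓ θ₁ u₁ x v y)) ∂(velMeasure u₁ θ₁ x) ≤
      ENNReal.ofReal (B * Real.exp (γ₁ * (4 / R' + 2 * (1 + (M ^ 2 / 2 + 3 / 2 * M)) + 2 * B) *
        ((Finset.univ.filter fun i => Torus.euclidDist y (x i) < ℓ).card : ℝ))) := by
  set N : ℝ := ((Finset.univ.filter fun i => Torus.euclidDist y (x i) < ℓ).card : ℝ)
  set c : ℝ := M ^ 2 / 2 + 3 / 2 * M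
  set K : ℝ := γ₁ * (4 / R' + 2 * (1 + c)) with hK
  -- the one-particle rates `sᵢ = 2γ₁ 𝟙[i ∈ ball] ∈ [0, γ₀]`
  set s : Fin m → ℝ := fun i => 2 * γ₁ * (if Torus.euclidDist y (x i) < ℓ then (1 : ℝ) else 0) with hs
  have hs0 : ∀ i, 0 ≤ s i ∧ s i ≤ γ₀ := fun i => by
    simp only [hs]
    split_ifs
    · rw [mul_one]; exact ⟨by positivity, h2γ⟩
    · rw [mul_zero]; exact ⟨le_rfl, (by positivity : (0:ℝ) ≤ 2 * γ₁).trans h2γ⟩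
  have hsum : ∑ i, s i = 2 * γ₁ * N := by
    simp only [hs]
    rw [← Finset.mul_sum, Finset.sum_boole]
  -- pointwise domination by a constant times a product of one-particle factors
  have hpt : ∀ v : Fin m → V3,
      ENNReal.ofReal (Real.exp (γ₁ * ((m : ℝ) * (4 / 3 * Real.pi * ℓ ^ 3)) * chessIntegrand M ℓ θ₁ u₁ x v y)) ≤
        ENNReal.ofReal (Real.exp (K * N)) *
          ∏ i, ENNReal.ofReal (Real.exp (s i * max 0 (‖v i‖ ^ 2 / 2 - ‖u₁ (x i)‖ ^ 2 / 2 - 3 / 2 * θ₁ (x i)))) := by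
    intro v
    rw [← ENNReal.ofReal_prod_of_nonneg fun i _ => (Real.exp_pos _).le, ← Real.exp_sum,
      ← ENNReal.ofReal_mul (Real.exp_pos _).le, ← Real.exp_add]
    refine ENNReal.ofReal_le_ofReal (Real.exp_le_exp.2 ?_)
    have h := pb_exponent_le_crowded hM hR' hγ₁ hν θ₁ u₁ x y hN v
    simpa only [hs, hK, mul_assoc] using h
  -- the one-particle factors, by hypothesis (ii)
  have hfac : ∀ i, ∫⁻ w, ENNReal.ofReal (Real.exp (s i * max 0 (‖w‖ ^ 2 / 2 - ‖u₁ (x i)‖ ^ 2 / 2 -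
      3 / 2 * θ₁ (x i)))) ∂(gaussMeasure (u₁ (x i)) (θ₁ (x i))) ≤ ENNReal.ofReal (Real.exp (B * s i)) :=
    fun i => hII (s i) (hs0 i).1 (hs0 i).2 _ _ (hbox _).1 (hbox _).2.1 (hbox _).2.2
  have hmeas : ∀ i, Measurable fun w : V3 => ENNReal.ofReal (Real.exp (s i * max 0 (‖w‖ ^ 2 / 2 -
      ‖u₁ (x i)‖ ^ 2 / 2 - 3 / 2 * θ₁ (x i)))) := fun i =>
    (Real.measurable_exp.comp ((measurable_const.max ((((measurable_norm.pow_const 2).div_const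
      2).sub_const _).sub_const _)).const_mul _)).ennreal_ofReal
  calc ∫⁻ v, ENNReal.ofReal (Real.exp (γ₁ * ((m : ℝ) * (4 / 3 * Real.pi * ℓ ^ 3)) *
          chessIntegrand M ℓ θ₁ u₁ x v y)) ∂(velMeasure u₁ θ₁ x)
      ≤ ∫⁻ v, ENNReal.ofReal (Real.exp (K * N)) *
          ∏ i, ENNReal.ofReal (Real.exp (s i * max 0 (‖v i‖ ^ 2 / 2 - ‖u₁ (x i)‖ ^ 2 / 2 - 3 / 2 * θ₁ (x i))))
          ∂(velMeasure u₁ θ₁ x) := lintegral_mono hpt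
    _ = ENNReal.ofReal (Real.exp (K * N)) * ∏ i, ∫⁻ w, ENNReal.ofReal (Real.exp (s i *
          max 0 (‖w‖ ^ 2 / 2 - ‖u₁ (x i)‖ ^ 2 / 2 - 3 / 2 * θ₁ (x i)))) ∂(gaussMeasure (u₁ (x i)) (θ₁ (x i))) := by
        rw [lintegral_const_mul' _ _ ENNReal.ofReal_ne_top]
        unfold velMeasure
        rw [lintegral_fintype_prod_eq_prod' _ hmeas]
    _ ≤ ENNReal.ofReal (Real.exp (K * N)) * ∏ i, ENNReal.ofReal (Real.exp (B * s i)) :=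
        mul_le_mul_right (Finset.prod_le_prod' fun i _ => hfac i) _
    _ = ENNReal.ofReal (Real.exp (K * N + B * (2 * γ₁ * N))) := by
        rw [← ENNReal.ofReal_prod_of_nonneg fun i _ => (Real.exp_pos _).le, ← Real.exp_sum,
          ← ENNReal.ofReal_mul (Real.exp_pos _).le, ← Real.exp_add, ← Finset.mul_sum, hsum]
    _ ≤ ENNReal.ofReal (B * Real.exp (γ₁ * (4 / R' + 2 * (1 + c) + 2 * B) * N)) := by
        refine ENNReal.ofReal_le_ofReal ?_
        rw [show K * N + B * (2 * γ₁ * N) = γ₁ * (4 / R' + 2 * (1 + c) + 2 * B) * N by rw [hK]; ring]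
        exact le_mul_of_one_le_left (Real.exp_pos _).le hB

/-- **Per-ball exponential moment of the chessboard integrand.** Under the velocity law given the positions,
for `γ₁ (2 + 2(1 + (1+c_M)R')) ≤ γ₀` and a ball of nominal content `ν = m · 4/3 π ℓ³ ≥ 1` holding `N` particles,
`∫ exp(γ₁ ν · chessIntegrand) d velMeasure ≤ B · exp(γ₁ (4/R' + 2(1+c_M) + 2B) · N 𝟙{N > R'ν})`: a normal ball
(`N ≤ R'ν`) costs `B` by hypothesis (i) of the ball Gaussian estimate after restriction to the block of its
particles, a crowded ball the deterministic `exp(γ₁ C N)` by the cap, the product structure and hypothesis (ii).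
[cite: Yau1991, §2] -/
theorem lintegral_exp_chessIntegrand_le : ∀ {M R' γ₀ B : ℝ}, 1 ≤ M → 1 ≤ R' → 0 < γ₀ → 1 ≤ B → (∀ ν : ℝ, 1 ≤ ν → ∀ k : ℕ, (k : ℝ) ≤ R' * ν → ∀ (u : Fin k → V3) (θ : Fin k → ℝ), (∀ i, M⁻¹ ≤ θ i ∧ θ i ≤ M ∧ ‖u i‖ ≤ M) → ∫⁻ v, ENNReal.ofReal (Real.exp (γ₀ * (min ν (‖∑ i, (v i - u i)‖ ^ 2 / ν) + min ν ((∑ i, (‖v i‖ ^ 2 / 2 - ‖u i‖ ^ 2 / 2 - 3 / 2 * θ i)) ^ 2 / ν) + (if ν < ∑ i, (‖v i‖ ^ 2 / 2 - ‖u i‖ ^ 2 / 2 - 3 / 2 * θ i) then ∑ i, (‖v i‖ ^ 2 / 2 - ‖u i‖ ^ 2 / 2 - 3 / 2 * θ i) else 0)))) ∂(Measure.pi fun i => gaussMeasure (u i) (θ i)) ≤ ENNReal.ofReal B) → (∀ s : ℝ, 0 ≤ s → s ≤ γ₀ → ∀ (u : V3) (θ : ℝ), M⁻¹ ≤ θ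 → θ ≤ M → ‖u‖ ≤ M → ∫⁻ v, ENNReal.ofReal (Real.exp (s * max 0 (‖v‖ ^ 2 / 2 - ‖u‖ ^ 2 / 2 - 3 / 2 * θ))) ∂(gaussMeasure u θ) ≤ ENNReal.ofReal (Real.exp (B * s))) → ∀ {m : ℕ} {ℓ : ℝ}, 0 < ℓ → ℓ < 1 / 2 → 1 ≤ (m : ℝ) * (4 / 3 * Real.pi * ℓ ^ 3) → ∀ {θ₁ : T3 → ℝ} {u₁ : T3 → V3}, (∀ y, M⁻¹ ≤ θ₁ y ∧ θ₁ y ≤ M ∧ ‖u₁ y‖ ≤ M) → ∀ {γ₁ : ℝ}, 0 ≤ γ₁ → γ₁ * (2 + 2 * (1 + (1 + (M ^ 2 / 2 + 3 / 2 * M)) * R')) ≤ γ₀ → ∀ (x : Fin m → T3) (y : T3), ∫⁻ v, ENNReal.ofReal (Real.exp (γ₁ * ((m : ℝ) * (4 / 3 * Real.pi * ℓ ^ 3)) * chessIntegrand M ℓ θ₁ u₁ x v y)) ∂(velMeasure u₁ θ₁ x) ≤ ENNReal.ofReal (B * Real.exp (γ₁ * (4 / R' + 2 * (1 + (M ^ 2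 / 2 + 3 / 2 * M)) + 2 * B) * (if R' * ((m : ℝ) * (4 / 3 * Real.pi * ℓ ^ 3)) < ((Finset.univ.filter fun i => Torus.euclidDist y (x i) < ℓ).card : ℝ) then ((Finset.univ.filter fun i => Torus.euclidDist y (x i) < ℓ).card : ℝ) else 0))) := by
  intro M R' γ₀ B hM hR' hγ₀ hB hI hII m ℓ hℓ hℓh hν θ₁ u₁ hbox γ₁ hγ₁ hγW x y
  have hν0 : 0 < (m : ℝ) * (4 / 3 * Real.pi * ℓ ^ 3) := one_pos.trans_le hν
  have h2γ : 2 * γ₁ ≤ γ₀ := by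
    have hc0 : 0 ≤ (1 + (M ^ 2 / 2 + 3 / 2 * M)) * R' := by positivity
    nlinarith
  split_ifs with h
  · exact pb_lintegral_crowded_le hM (one_pos.trans_le hR') hB hII hν0 hbox hγ₁ h2γ x y h
  · rw [mul_zero, Real.exp_zero, mul_one]
    exact pb_lintegral_normal_le hM hI hν hbox hγ₁ hγW x y (not_lt.1 h)

end Summit.AtomisticToContinuum.HydrodynamicLimit.Theorems.NearConstantShortTimeHL
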